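import Literature.RingTheory.FormalGroups.FormalGroupHom
import Literature.RingTheory.FormalGroups.DegreeCongruence
import HarnessLib

/-!
# The formal group law with a given logarithm: `F(X,Y) = f⁻¹(f(X) + f(Y))`
# ([Hazewinkel 1978] §1.5, (1.5.5)–(1.5.7); [Lazard 1955] §II)

Topic `Literature/RingTheory/FormalGroups`; namespace `Literature.RingTheory.FormalGroups`.  One DEFINITION
(`FormalGroup.ofLogarithm`, on Mathlib's carrier `FormalGroup`) + fully proved theorems; no named fact, no instance, no
`sorry`.  For a STRICT power series `f(X) = X + ⋯ ∈ K⟦X⟧` (`f(0) = 0`, `[X¹]f = 1`) over a commutative ring `K`, the series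
`F_f(X,Y) = f⁻¹(f(X) + f(Y))` is a commutative one-dimensional formal group law over `K` with logarithm `f`
(`f(F_f(X,Y)) = f(X) + f(Y)`); `f⁻¹` is Mathlib's `PowerSeries.substInvOfIsUnit`.  (Over a `ℚ`-algebra every commutative law
is of this form; here only the construction is needed — it is the vehicle of Hazewinkel's functional-equation laws
`F_V`, `F_U`, whose integrality is proved elsewhere.)

* `logLawSeries f hf1` — the series `f⁻¹(f(X₀) + f(X₁))`; `logLawSeries_subst` (its value `f⁻¹(f(a₀) + f(a₁))` on arguments),
  `log_subst_logLawSeries` (`f(F_f(a₀,a₁)) = f(a₀) + f(a₁)`), `two_le_order_logLawSeries_sub` (`F_f ≡ X₀ + X₁ (mod deg 2)`).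
* `FormalGroup.ofLogarithm f hf0 hf1 : FormalGroup K` and `FormalGroup.ofLogarithm_isComm`.
* `le_order_sub_of_log_subst` — `f` is injective modulo degrees: `f(U) ≡ f(U') (mod deg N) ⇒ U ≡ U' (mod deg N)`.

## References
* [Hazewinkel1978] M. Hazewinkel, *Formal Groups and Applications* (1978), §1.5 (logarithms), §2.2 (the laws `f_g⁻¹(f_g(X)+f_g(Y))`).
* [Lazard1955] M. Lazard, Bull. SMF 83 (1955), §II (laws over `ℚ`-algebras via their logarithm).
-/

noncomputable section

namespace Literature.RingTheory.FormalGroups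

open MvPowerSeries

universe u v

variable {K : Type u} [CommRing K] {τ : Type v}

section LogLaw

variable (f : PowerSeries K) (hf1 : PowerSeries.coeff 1 f = 1)

/-- `[X¹]f = 1` is a unit. [folklore] -/
private theorem isUnit_coeff_one (hf1 : PowerSeries.coeff 1 f = 1) : IsUnit (PowerSeries.coeff 1 f) := by
  rw [hf1]; exact isUnit_one

/-- The compositional inverse `f⁻¹` of a strict series (Mathlib's `substInvOfIsUnit`). [cite: Hazewinkel1978, §1.5] -/
def logInv : PowerSeries K := f.substInvOfIsUnit (isUnit_coeff_one f hf1)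

/-- `f⁻¹(0) = 0`. [cite: Hazewinkel1978, §1.5] -/
theorem constantCoeff_logInv : PowerSeries.constantCoeff (logInv f hf1) = 0 :=
  PowerSeries.constantCoeff_substInvOfIsUnit _ _

/-- `[X¹]f⁻¹ = 1`. [cite: Hazewinkel1978, §1.5] -/
theorem coeff_one_logInv : PowerSeries.coeff 1 (logInv f hf1) = 1 := by
  rw [logInv, PowerSeries.coeff_one_substInvOfIsUnit]
  set u := (isUnit_coeff_one f hf1).unit with hu
  have h : (u : K) = 1 := (isUnit_coeff_one f hf1).unit_spec.trans hf1
  calc ((u⁻¹ : Kˣ) : K) = ((u⁻¹ : Kˣ) : K) * (u : K) := by rw [h, mul_one]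
    _ = 1 := Units.inv_mul u

variable (hf0 : PowerSeries.constantCoeff f = 0)

include hf0 in
/-- `f(f⁻¹(X)) = X`. [cite: Hazewinkel1978, §1.5] -/
theorem subst_logInv : PowerSeries.subst (logInv f hf1) f = PowerSeries.X :=
  PowerSeries.subst_substInvOfIsUnit_right f hf0 _

include hf0 in
/-- `f⁻¹(f(X)) = X`. [cite: Hazewinkel1978, §1.5] -/
theorem logInv_subst : PowerSeries.subst f (logInv f hf1) = PowerSeries.X :=
  PowerSeries.subst_substInvOfIsUnit_left f hf0 _

/-- The series `F_f(X₀,X₁) = f⁻¹(f(X₀) + f(X₁))`. [cite: Hazewinkel1978, §2.2 (2.2.4)] -/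
def logLawSeries : MvPowerSeries (Fin 2) K :=
  PowerSeries.subst (PowerSeries.subst (X 0 : MvPowerSeries (Fin 2) K) f + PowerSeries.subst (X 1) f) (logInv f hf1)

include hf0 in
/-- `f(a)` has no constant term when `a` has none. [folklore] -/
private theorem constantCoeff_psubst {a : MvPowerSeries τ K} (ha : constantCoeff a = 0) :
    constantCoeff (PowerSeries.subst a f) = 0 :=
  PowerSeries.constantCoeff_subst_eq_zero ha f hf0

include hf0 in
/-- `f(a₀) + f(a₁)` has no constant term. [folklore] -/
private theorem constantCoeff_logSum {a₀ a₁ : MvPowerSeries τ K} (h₀ : constantCoeff a₀ = 0) (h₁ : constantCoeff a₁ = 0) :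
    constantCoeff (PowerSeries.subst a₀ f + PowerSeries.subst a₁ f) = 0 := by
  rw [map_add, constantCoeff_psubst f hf0 h₀, constantCoeff_psubst f hf0 h₁, add_zero]

include hf0 in
/-- **Evaluation**: `F_f(a₀,a₁) = f⁻¹(f(a₀) + f(a₁))` for arguments without constant term. [cite: Hazewinkel1978, §2.2 (2.2.4)] -/
theorem logLawSeries_subst {a : Fin 2 → MvPowerSeries τ K} (ha : ∀ i, constantCoeff (a i) = 0) :
    subst a (logLawSeries f hf1) =
      PowerSeries.subst (PowerSeries.subst (a 0) f + PowerSeries.subst (a 1) f) (logInv f hf1) := by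
  have has : HasSubst a := hasSubst_of_constantCoeff_zero ha
  have hw : PowerSeries.HasSubst (PowerSeries.subst (X 0 : MvPowerSeries (Fin 2) K) f + PowerSeries.subst (X 1) f) :=
    PowerSeries.HasSubst.of_constantCoeff_zero (constantCoeff_logSum f hf0 (constantCoeff_X 0) (constantCoeff_X 1))
  rw [logLawSeries, subst_powerSeries_subst hw has, subst_add has,
    subst_powerSeries_subst (PowerSeries.HasSubst.X 0) has, subst_powerSeries_subst (PowerSeries.HasSubst.X 1) has,
    subst_X has, subst_X has]

include hf0 in
/-- **`f` is the logarithm of `F_f`**: `f(F_f(a₀,a₁)) = f(a₀) + f(a₁)`. [cite: Hazewinkel1978, §2.2 (2.2.4)] -/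
theorem log_subst_logLawSeries {a : Fin 2 → MvPowerSeries τ K} (ha : ∀ i, constantCoeff (a i) = 0) :
    PowerSeries.subst (subst a (logLawSeries f hf1)) f = PowerSeries.subst (a 0) f + PowerSeries.subst (a 1) f := by
  have hw : PowerSeries.HasSubst (PowerSeries.subst (a 0) f + PowerSeries.subst (a 1) f) :=
    PowerSeries.HasSubst.of_constantCoeff_zero (constantCoeff_logSum f hf0 (ha 0) (ha 1))
  rw [logLawSeries_subst f hf1 hf0 ha,
    ← PowerSeries.subst_comp_subst_apply (PowerSeries.HasSubst.of_constantCoeff_zero' (constantCoeff_logInv f hf1)) hw,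
    subst_logInv f hf1 hf0, PowerSeries.subst_X hw]

include hf0 in
/-- `F_f(a₀,a₁)` has no constant term. [cite: Hazewinkel1978, §1.1 (1.1.2)] -/
theorem constantCoeff_logLawSeries_subst {a : Fin 2 → MvPowerSeries τ K} (ha : ∀ i, constantCoeff (a i) = 0) :
    constantCoeff (subst a (logLawSeries f hf1)) = 0 := by
  rw [logLawSeries_subst f hf1 hf0 ha]
  exact PowerSeries.constantCoeff_subst_eq_zero (constantCoeff_logSum f hf0 (ha 0) (ha 1)) _ (constantCoeff_logInv f hf1)

include hf0 in
/-- `F_f(a₀,a₁) ≡ a₀ + a₁ (mod deg 2)` for arguments without constant term. [cite: Hazewinkel1978, §1.1] -/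
theorem two_le_order_logLawSeries_subst_sub {a : Fin 2 → MvPowerSeries τ K} (ha : ∀ i, constantCoeff (a i) = 0) :
    ((2 : ℕ) : ℕ∞) ≤ (subst a (logLawSeries f hf1) - (a 0 + a 1)).order := by
  rw [logLawSeries_subst f hf1 hf0 ha]
  set w := PowerSeries.subst (a 0) f + PowerSeries.subst (a 1) f with hw
  have hw0 : constantCoeff w = 0 := constantCoeff_logSum f hf0 (ha 0) (ha 1)
  -- `f⁻¹(w) ≡ w (mod deg 2)`
  have h1 := le_order_psubst_sub_psubst_sub (constantCoeff_logInv f hf1) (coeff_one_logInv f hf1) le_rfl hw0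
    (constantCoeff_zero) (by simpa using one_le_order_of_constantCoeff hw0)
  rw [PowerSeries.subst_zero_of_constantCoeff_zero (constantCoeff_logInv f hf1), sub_zero, sub_zero] at h1
  -- `f(aᵢ) ≡ aᵢ (mod deg 2)`
  have h2 : ∀ i, ((2 : ℕ) : ℕ∞) ≤ (PowerSeries.subst (a i) f - a i).order := by
    intro i
    have h := le_order_psubst_sub_psubst_sub hf0 hf1 le_rfl (ha i) (constantCoeff_zero)
      (by simpa using one_le_order_of_constantCoeff (ha i))
    rwa [PowerSeries.subst_zero_of_constantCoeff_zero hf0, sub_zero, sub_zero] at h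
  have h3 : ((2 : ℕ) : ℕ∞) ≤ (w - (a 0 + a 1)).order := by
    have e : w - (a 0 + a 1) = (PowerSeries.subst (a 0) f - a 0) + (PowerSeries.subst (a 1) f - a 1) := by rw [hw]; ring
    rw [e]; exact natCast_le_order_add (h2 0) (h2 1)
  exact natCast_le_order_sub_trans h1 h3

include hf0 in
/-- `F_f ≡ X₀ + X₁ (mod deg 2)`. [cite: Hazewinkel1978, §1.1] -/
theorem two_le_order_logLawSeries_sub :
    ((2 : ℕ) : ℕ∞) ≤ (logLawSeries f hf1 - (X 0 + X 1)).order := by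
  have h := two_le_order_logLawSeries_subst_sub f hf1 hf0 (a := (X : Fin 2 → MvPowerSeries (Fin 2) K))
    (fun i => constantCoeff_X i)
  rwa [subst_self] at h

include hf0 in
/-- **The formal group law with logarithm `f`**: `F_f(X,Y) = f⁻¹(f(X) + f(Y))` is a one-dimensional formal group law
(associativity: both sides of `F(F(X,Y),Z) = F(X,F(Y,Z))` equal `f⁻¹(f(X) + f(Y) + f(Z))`). [cite: Hazewinkel1978, §1.5 (1.5.7), §2.2] -/
def FormalGroup.ofLogarithm : FormalGroup K where
  toPowerSeries := logLawSeries f hf1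
  zero_constantCoeff := by
    have h := constantCoeff_logLawSeries_subst f hf1 hf0 (a := (X : Fin 2 → MvPowerSeries (Fin 2) K))
      (fun i => constantCoeff_X i)
    rwa [subst_self] at h
  lin_coeff_X := by
    classical
    have h := (natCast_le_order_sub_iff.mp (two_le_order_logLawSeries_sub f hf1 hf0)) (Finsupp.single 0 1)
      (by rw [Finsupp.degree_single]; norm_num)
    rw [h, map_add, coeff_index_single_X, coeff_index_single_X]; simp
  lin_coeff_Y := by
    classical
    have h := (natCast_le_order_sub_iff.mp (two_le_order_logLawSeries_sub f hf1 hf0)) (Finsupp.single 1 1)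
      (by rw [Finsupp.degree_single]; norm_num)
    rw [h, map_add, coeff_index_single_X, coeff_index_single_X]; simp
  assoc := by
    have h01 : ∀ i, constantCoeff ((![X 0, X 1] : Fin 2 → MvPowerSeries (Fin 3) K) i) = 0 := by
      intro i; fin_cases i <;> simp
    have h12 : ∀ i, constantCoeff ((![X 1, X 2] : Fin 2 → MvPowerSeries (Fin 3) K) i) = 0 := by
      intro i; fin_cases i <;> simp
    have hL : ∀ i, constantCoeff ((![subst ![X 0, X 1] (logLawSeries f hf1), X 2] : Fin 2 → MvPowerSeries (Fin 3) K) i) = 0 := by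
      intro i; fin_cases i
      · exact constantCoeff_logLawSeries_subst f hf1 hf0 h01
      · simp
    have hR : ∀ i, constantCoeff ((![X 0, subst ![X 1, X 2] (logLawSeries f hf1)] : Fin 2 → MvPowerSeries (Fin 3) K) i) = 0 := by
      intro i; fin_cases i
      · simp
      · exact constantCoeff_logLawSeries_subst f hf1 hf0 h12
    change subst _ (logLawSeries f hf1) = subst _ (logLawSeries f hf1)
    rw [logLawSeries_subst f hf1 hf0 hL, logLawSeries_subst f hf1 hf0 hR]
    simp only [Matrix.cons_val_zero, Matrix.cons_val_one]
    rw [log_subst_logLawSeries f hf1 hf0 h01, log_subst_logLawSeries f hf1 hf0 h12]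
    simp only [Matrix.cons_val_zero, Matrix.cons_val_one, add_assoc]

/-- The series of `FormalGroup.ofLogarithm f` is `f⁻¹(f(X₀) + f(X₁))`. [cite: Hazewinkel1978, §2.2] -/
@[simp] theorem FormalGroup.ofLogarithm_toPowerSeries :
    (FormalGroup.ofLogarithm f hf1 hf0).toPowerSeries = logLawSeries f hf1 := rfl

include hf0 in
/-- `F_f` is commutative. [cite: Hazewinkel1978, §1.5] -/
theorem FormalGroup.ofLogarithm_isComm : (FormalGroup.ofLogarithm f hf1 hf0).IsComm := by
  refine ⟨?_⟩
  have h10 : ∀ i, constantCoeff ((![X 1, X 0] : Fin 2 → MvPowerSeries (Fin 2) K) i) = 0 := by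
    intro i; fin_cases i <;> simp
  change logLawSeries f hf1 = subst _ (logLawSeries f hf1)
  rw [logLawSeries_subst f hf1 hf0 h10]
  simp only [Matrix.cons_val_zero, Matrix.cons_val_one]
  rw [logLawSeries, add_comm]

include hf1 hf0 in
/-- **`f` is injective modulo degrees**: if `f(U) ≡ f(U') (mod deg N)` for `U, U'` without constant term then
`U ≡ U' (mod deg N)` (apply `f⁻¹` and Lazard's Lemme 1). [cite: Lazard1955, §I Lemme 1] -/
theorem le_order_sub_of_log_subst {N : ℕ} {U U' : MvPowerSeries τ K} (hU : constantCoeff U = 0)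
    (hU' : constantCoeff U' = 0) (h : (N : ℕ∞) ≤ (PowerSeries.subst U f - PowerSeries.subst U' f).order) :
    (N : ℕ∞) ≤ (U - U').order := by
  have key : ∀ V : MvPowerSeries τ K, constantCoeff V = 0 →
      PowerSeries.subst (PowerSeries.subst V f) (logInv f hf1) = V := by
    intro V hV
    rw [← PowerSeries.subst_comp_subst_apply (PowerSeries.HasSubst.of_constantCoeff_zero' hf0)
      (PowerSeries.HasSubst.of_constantCoeff_zero hV), logInv_subst f hf1 hf0,
      PowerSeries.subst_X (PowerSeries.HasSubst.of_constantCoeff_zero hV)]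
  have h' := le_order_psubst_sub_psubst' (logInv f hf1) (constantCoeff_psubst f hf0 hU) (constantCoeff_psubst f hf0 hU') h
  rwa [key U hU, key U' hU'] at h'

end LogLaw

end Literature.RingTheory.FormalGroups
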